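import Literature.AnabelianGeometry.EtaleTheta.FrobenioidMonoThetaEnv
import Literature.AnabelianGeometry.EtaleTheta.Discharge.Sec5Cor512UniversalClosureRefuted
import Mathlib.Algebra.Group.Units.Equiv
import Mathlib.Algebra.Group.TypeTags.Finite
import Mathlib.GroupTheory.QuotientGroup.Basic

/-!
# [EtTh] Lemma 5.9 (v): the universal closure of the named fact `CycRigidityCoincide` is FALSE as typed
# (kernel countermodel; FROZEN FACT-LIST row F-0544 — R5 «named instances only»); boundary case `N = 1` PROVED

Mochizuki, *The étale theta function and its Frobenioid-theoretic manifestations*, Publ. RIMS **45** (2009),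
Lemma 5.9 (v), p.332 (PDF p.106) [cite: MochizukiEtTh2009, Lem 5.9 (v) p.332 (PDF p.106)]: "In the situation of
(iv), the cyclotomic rigidity isomorphism arising from the theory of §2 [cf. Corollary 2.19, (i)] coincides with
the Frobenioid-theoretic isomorphism of Proposition 5.5 [where we take '`S`' to be `B_N`]."  Cell abc-iut, block C
(F-TRANCHES lane, tranche 123), seat abc-iut-w5-d026; PROOF-ONLY companion of abc-iut-L2-t4's
`FrobenioidMonoThetaEnv.lean` (statement `ThetaFrobenioid.CycRigidityCoincide ρ219 ρ hB : ρ B_N hB = ρ219`).  No new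
`Prop` fact, no statement file edited; the only definitions below are toy data.

WHAT IS PROVED.
* `not_forall_cycRigidityCoincide` (**F-0544**): the universal closure
  `∀ C D (𝔉 : ThetaFrobenioid C D) ρ219 ρ hB, 𝔉.CycRigidityCoincide ρ219 ρ hB` is FALSE.  As typed, `ρ219` (the §2
  isomorphism `(l·Δ_Θ)_{B_N} ⊗ ℤ/Nℤ ⥲ μ_N(B_N)` of Cor. 2.19 (i), a `TODO-merge(abc-iut-L2-t2)` PARAMETER) and the
  Prop. 5.5 family `ρ` are FREE data, so the closure asserts that ANY two isomorphisms `(l·Δ_Θ)_{B_N} ⊗ ℤ/Nℤ ⥲ μ_N(B_N)`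
  coincide — false as soon as `μ_N(B_N)` has order `≥ 3`.  Witness (all universes `0`): the toy §5 datum `toyTheta₃`
  with `C := SingleObj ℤ/3` (one object `⋆ = A_⊚ = A_N = B_N`, `Aut_C(⋆) = O^×(⋆) = μ_3(⋆) = ℤ/3`), base CONSTANT to the
  one-object discrete category, all Frobenius degrees `1`, `l = 1`, `N = 3`, `(l·Δ_Θ)_E := ℤ/3`, `Π^tp_X := ℤ × ℤ/2`,
  `Π^tp_Ÿ := 1`, all sections trivial; `B_N = ⋆` IS `(1,3)`-theta-saturated (`isThetaSaturated_toy`); the family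
  `ρfam` (the evident identification) and `ρ219 := ρfam ∘ (x ↦ x⁻¹)` differ at the generator.
* `cycRigidityCoincide_of_N_eq_one` (boundary, POSITIVE, every `𝔉`): when `N = 1` the target `μ_1(B_N)` is trivial,
  so the row holds for every `ρ219, ρ, hB` — the typed row carries content only through the order of `μ_N(B_N)`.
WHAT THIS MEANS (R5).  F-0544 is an assumption on the NAMED §5 data together with the NAMED §2 isomorphism, never
a theorem of the interface; the instance forms that stand are abc-iut-L2-d4's PROVED reductions
`ThetaFrobenioid.cycRigidityCoincide_of` (`Discharge/Sec5BiThetaIso.lean`, from the bi-theta isomorphism of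
Lemma 5.9 (iv)) and `cycRigidityCoincide_of_biTheta` (`Discharge/Sec5Lem59vTransport.lean`).  Companion rows of
the same file: F-0545 `EnvIsoBiTheta` / F-0546 `FrdIsMonoThetaEnv` (abc-iut-f-115), F-0547 `MonoThetaEnvCompat`
(Thm. 5.10 (iii): SUB-NODE — closers `monoThetaEnvCompat_of_psiAutPreserves`,
`exists_monoThetaIso_of_psiAutPreserves_empty` of `Discharge/Sec5Thm510.lean`, modulo Thm. 5.10 (ii) = F-0541,
whose closure is refuted in `Discharge/Sec5MonoThetaUniversalClosureRefuted.lean`).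
HONEST FRAMING: a toy datum says nothing about the tempered Frobenioid of [EtTh] §5, nothing about Lemma 5.9 (v)
in print, nothing about [IUTchIII] Cor. 3.12; refuted-as-schema ≠ refuted-in-print; no side taken; typed ≠ proved.
-/

namespace Literature.AnabelianGeometry.EtaleTheta

namespace ThetaFrobenioid

open CategoryTheory
open Literature.AlgebraicGeometry.Frobenioids

universe w v v' u u'

/-! ### Boundary case `N = 1` (positive, for every §5 datum) -/

section Boundary

variable {C : Type u} [Category.{v} C] {D : Type u'} [Category.{v'} D] (𝔉 : ThetaFrobenioid.{w} C D)

/-- `μ_1(S)` is trivial: an `M`-torsion unit with `M = 1` is the identity.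
[cite: MochizukiEtTh2009, Def 5.4 p.327 (PDF p.101)] -/
theorem coe_eq_one_of_mem_muTorsion_one {S : C} (u : 𝔉.muTorsion S 1) : (u : Aut S) = 1 := by
  have h := (𝔉.mem_muTorsion.mp u.2).2
  rwa [pow_one] at h

/-- **Lemma 5.9 (v) at `N = 1` holds for EVERY datum** (the target cyclotome `μ_1(B_N)` is trivial, so any two
isomorphisms onto it coincide): the typed row F-0544 has content only through the order of `μ_N(B_N)`.
[cite: MochizukiEtTh2009, Lem 5.9 (v) p.332 (PDF p.106)] -/
theorem cycRigidityCoincide_of_N_eq_one (hN : 𝔉.N = 1)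
    (ρ219 : 𝔉.lDeltaModN 𝔉.BN ≃* 𝔉.muTorsion 𝔉.BN 𝔉.N)
    (ρ : FrobenioidCyclotomicRigidity.RigidityFamily 𝔉) (hB : 𝔉.IsThetaSaturated 𝔉.BN) :
    𝔉.CycRigidityCoincide ρ219 ρ hB := by
  have key : ∀ u : 𝔉.muTorsion 𝔉.BN 𝔉.N, (u : Aut 𝔉.BN) = 1 := by
    rw [hN]
    exact 𝔉.coe_eq_one_of_mem_muTorsion_one
  apply MulEquiv.ext
  intro x
  exact Subtype.ext ((key _).trans (key _).symm)

end Boundary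

/-! ### The toy datum over `C := SingleObj ℤ/3` -/

namespace Lem59vToy

open ConstantMultiple.Cor512Toy (Mm TD kerFstEquiv)

/-- The coefficient group `ℤ/3`, written multiplicatively (plays `Aut_C(⋆) = O^×(⋆) = μ_3(⋆)`, `(l·Δ_Θ)_E` and
`O^×(⋆^birat)`). [cite: MochizukiEtTh2009, Def 5.4 p.327 (PDF p.101)] -/
abbrev M3 : Type := Multiplicative (ZMod 3)

/-- The generator `g₀` of `ℤ/3`. [cite: MochizukiEtTh2009, Def 5.4 p.327 (PDF p.101)] -/
abbrev g0 : M3 := Multiplicative.ofAdd 1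

/-- The toy category `C := SingleObj ℤ/3` (one object `⋆` with `Aut_C(⋆) = ℤ/3`).
[cite: MochizukiEtTh2009, §5 p.322 (PDF p.96)] -/
abbrev TC3 : Type := SingleObj M3

/-- Every element of `ℤ/3` has cube `1`. [folklore] -/
private theorem pow_three_eq_one : ∀ x : M3, x ^ 3 = 1 := by decide

/-- The generator of `ℤ/3` is not its own inverse. [folklore] -/
private theorem g0_ne_inv : g0 ≠ g0⁻¹ := by decide

/-- `Aut_C(S) → ℤ/3`, `a ↦ a.hom` (plays `O^×(S) ↪ O^×(S^birat)`). [cite: MochizukiEtTh2009, §5 p.331 (PDF p.105)] -/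
def autToM3 (S : TC3) : Aut S →* M3 where
  toFun a := a.hom
  map_one' := rfl
  map_mul' _ _ := rfl

/-- `ℤ/3 → Aut_C(S)`, `m ↦ (m, m⁻¹)`. [cite: MochizukiEtTh2009, §5 p.331 (PDF p.105)] -/
def toAut3 (S : TC3) : M3 →* Aut S where
  toFun m := ⟨m, (m⁻¹ : M3), inv_mul_cancel m, mul_inv_cancel m⟩
  map_one' := Aut.ext rfl
  map_mul' _ _ := Aut.ext rfl

/-- Automorphism groups of `C` are commutative (`ℤ/3` is). [cite: MochizukiEtTh2009, §5 p.322 (PDF p.96)] -/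
theorem aut_mul_comm₃ (S : TC3) (a b : Aut S) : a * b = b * a := by
  apply Aut.ext
  change (b.hom ≫ a.hom) = (a.hom ≫ b.hom)
  exact @mul_comm M3 _ a.hom b.hom

/-- The toy pre-Frobenioid data: constant base, trivial divisors, all Frobenius degrees `1`.
[cite: MochizukiEtTh2009, §5 p.322 (PDF p.96)] -/
def toyPre₃ : PreFrobenioidData.{0} TC3 TD where
  base := (Functor.const TC3).obj ⟨PUnit.unit⟩
  Mon := fun _ => Unit
  pull := fun _ => MonoidHom.id Unit
  pull_id := fun _ _ => rfl
  pull_comp := fun _ _ _ => rfl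
  div := fun _ => ()
  degFr := fun _ => 1
  div_id := fun _ => rfl
  div_comp := fun _ _ => rfl
  degFr_id := fun _ => rfl
  degFr_comp := fun _ _ => (one_mul 1).symm

/-- Every automorphism of `C` is a unit of the toy data (base-identity and linear).
[cite: MochizukiEtTh2009, §5 p.331 (PDF p.105)] -/
theorem mem_unitsSubgroup_toy (S : TC3) (a : Aut S) : a ∈ toyPre₃.unitsSubgroup S := ⟨rfl, rfl⟩

/-- The toy `TemperedFrobenioidStub`: `O^×(S^birat) := ℤ/3`, units read through `a ↦ a.hom`.
[cite: MochizukiEtTh2009, §5 p.331 (PDF p.105)] -/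
def toyStub₃ : FrobenioidTheta.TemperedFrobenioidStub.{0} TC3 TD where
  pre := toyPre₃
  units_comm S := ⟨⟨fun a b => Subtype.ext (aut_mul_comm₃ S a.1 b.1)⟩⟩
  biratUnits := fun _ => M3
  unitsToBirat S := (autToM3 S).comp (toyPre₃.unitsSubgroup S).subtype
  unitsToBirat_injective S := by
    intro a b h
    exact Subtype.ext (Aut.ext h)
  unitsPull := fun _ => 1
  IsBaseFrobeniusType := ⊤

/-- **The toy §5 datum** `𝔉_toy₃ : ThetaFrobenioid (SingleObj ℤ/3) (Discrete PUnit)`: every field of the DATA-ONLY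
interface supplied; `A_⊚ = A_N = B_N = ⋆`, `s^⊓_N = s^⊔_N = 𝟙`, `l = 1`, `N = 3`, `(l·Δ_Θ)_E := ℤ/3`, `Π^tp_X := ℤ × ℤ/2`
(discrete), `Π^tp_Ÿ := 1`, `K := 𝔽₂`, all sections trivial.  [cite: MochizukiEtTh2009, §5 p.322–333 (PDF pp.96–107)] -/
def toyTheta₃ : ThetaFrobenioid.{0} TC3 TD where
  toTemperedFrobenioidStub := toyStub₃
  lDelta := fun _ => M3
  lDeltaMap := fun _ => MonoidHom.id M3
  l := 1
  odd_l := odd_one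
  N := 3
  Acirc := SingleObj.star M3
  AN := SingleObj.star M3
  BN := SingleObj.star M3
  sCap := 𝟙 _
  sCup := 𝟙 _
  base_map_sCap := rfl
  isPreStep_sCap := ⟨rfl, by change IsIso (𝟙 _); infer_instance⟩
  isPreStep_sCup := ⟨rfl, by change IsIso (𝟙 _); infer_instance⟩
  PiX := Multiplicative ℤ × Mm
  zquot := MonoidHom.fst _ _
  zquot_surjective := fun z => ⟨(z, 1), rfl⟩
  PiYdd := ⊥
  PiYdd_le := bot_le
  relindex_PiYdd := by
    rw [Subgroup.relIndex_bot_left, Nat.card_congr kerFstEquiv, Nat.card_zmod]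
  PiYdd_normal := inferInstance
  isOpen_PiYdd := isOpen_discrete _
  ρ := 1
  ρ_surjective := fun g => ⟨1, Aut.ext (Subsingleton.elim _ _)⟩
  isOpen_ker_ρ := isOpen_discrete _
  strv := 1
  sgpCap := 1
  sgpCup := 1
  K := ZMod 2
  constEmb := 1
  constEmb_injective := by
    intro a b _
    have h : ∀ u : (ZMod 2)ˣ, u = 1 := by decide
    rw [h a, h b]
  thetaFn := (1 : M3)

/-- `N = 3` in the toy datum (as a natural number). [cite: MochizukiEtTh2009, §5 p.323 (PDF p.97)] -/
theorem toyTheta₃_N : ((toyTheta₃.N : ℕ+) : ℕ) = 3 := rfl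

/-- `l · N = 3` in the toy datum. [cite: MochizukiEtTh2009, Def 5.4 p.327 (PDF p.101)] -/
theorem toyTheta₃_lN : toyTheta₃.l * (toyTheta₃.N : ℕ) = 3 := rfl

/-- `μ_3(S) ⥲ ℤ/3` for every object of the toy datum: every automorphism is a unit and has cube `1`.
[cite: MochizukiEtTh2009, Def 5.4 p.327 (PDF p.101)] -/
def muTorsionEquiv (S : TC3) : toyTheta₃.muTorsion S 3 ≃* M3 where
  toFun u := (u : Aut S).hom
  invFun m := ⟨toAut3 S m, toyTheta₃.mem_muTorsion.mpr
    ⟨mem_unitsSubgroup_toy S _, by rw [← map_pow, pow_three_eq_one, map_one]⟩⟩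
  left_inv u := Subtype.ext (Aut.ext rfl)
  right_inv _ := rfl
  map_mul' _ _ := rfl

/-- The `N`-th power map of `(l·Δ_Θ)_E = ℤ/3` (`N = 3`) is trivial, so `(l·Δ_Θ) ⊗ ℤ/3 = ℤ/3 / 1`.
[cite: MochizukiEtTh2009, Def 5.4 p.327 (PDF p.101)] -/
theorem powN_range_eq_bot : (powMonoidHom (toyTheta₃.N : ℕ) : M3 →* M3).range = ⊥ := by
  rw [MonoidHom.range_eq_bot_iff, toyTheta₃_N]
  exact MonoidHom.ext fun x => pow_three_eq_one x

/-- `(l·Δ_Θ)_S ⊗ ℤ/Nℤ ⥲ ℤ/3` for every object of the toy datum. [cite: MochizukiEtTh2009, Def 5.4 p.327 (PDF p.101)] -/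
noncomputable def lDeltaModNEquiv (S : TC3) : toyTheta₃.lDeltaModN S ≃* M3 :=
  (QuotientGroup.quotientMulEquivOfEq powN_range_eq_bot).trans (QuotientGroup.quotientBot)

/-- `B_N = ⋆` is `(l, N) = (1, 3)`-theta-saturated in the toy datum: `μ_3(⋆) ≅ ℤ/3` and `(l·Δ_Θ)_⋆ ⊗ ℤ/3` has three
elements. [cite: MochizukiEtTh2009, Def 5.4 p.327 (PDF p.101)] -/
theorem isThetaSaturated_toy : toyTheta₃.IsThetaSaturated toyTheta₃.BN where
  muSaturated := by
    change Nonempty (toyTheta₃.muTorsion (SingleObj.star M3) (toyTheta₃.l * (toyTheta₃.N : ℕ)) ≃* _)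
    rw [toyTheta₃_lN]
    exact ⟨muTorsionEquiv (SingleObj.star M3)⟩
  card_lDeltaModN := by
    change Nat.card (toyTheta₃.lDeltaModN (SingleObj.star M3)) = ((toyTheta₃.N : ℕ+) : ℕ)
    rw [Nat.card_congr (lDeltaModNEquiv (SingleObj.star M3)).toEquiv, toyTheta₃_N,
      Nat.card_congr Multiplicative.toAdd, Nat.card_zmod]

/-- A toy Prop. 5.5-shaped rigidity family: the evident identification at every theta-saturated object.
[cite: MochizukiEtTh2009, Prop 5.5 p.327 (PDF p.101)] -/
noncomputable def ρfam : FrobenioidCyclotomicRigidity.RigidityFamily toyTheta₃ :=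
  fun S _ => (lDeltaModNEquiv S).trans (muTorsionEquiv S).symm

/-- A toy "§2" isomorphism `(l·Δ_Θ)_{B_N} ⊗ ℤ/3 ⥲ μ_3(B_N)`: the family's value at `B_N` precomposed with inversion.
[cite: MochizukiEtTh2009, Cor 2.19 (i) p.289 (PDF p.63)] -/
noncomputable def ρ219' : toyTheta₃.lDeltaModN toyTheta₃.BN ≃* toyTheta₃.muTorsion toyTheta₃.BN toyTheta₃.N :=
  ((lDeltaModNEquiv (SingleObj.star M3)).trans (MulEquiv.inv M3)).trans (muTorsionEquiv (SingleObj.star M3)).symm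

/-- Lemma 5.9 (v) FAILS at the toy datum for `(ρ219', ρfam)`: the two isomorphisms differ at the generator of `ℤ/3`.
[cite: MochizukiEtTh2009, Lem 5.9 (v) p.332 (PDF p.106)] -/
theorem not_cycRigidityCoincide_toy : ¬ toyTheta₃.CycRigidityCoincide ρ219' ρfam isThetaSaturated_toy := by
  intro h
  have h1 := MulEquiv.congr_fun h ((lDeltaModNEquiv (SingleObj.star M3)).symm g0)
  change ((lDeltaModNEquiv _).trans (muTorsionEquiv _).symm) ((lDeltaModNEquiv _).symm g0) =
    (((lDeltaModNEquiv _).trans (MulEquiv.inv M3)).trans (muTorsionEquiv _).symm)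
      ((lDeltaModNEquiv _).symm g0) at h1
  rw [MulEquiv.trans_apply, MulEquiv.trans_apply, MulEquiv.trans_apply, MulEquiv.apply_symm_apply,
    MulEquiv.inv_apply] at h1
  exact g0_ne_inv ((muTorsionEquiv (SingleObj.star M3)).symm.injective h1)

/-- **F-0544: the universal closure of `ThetaFrobenioid.CycRigidityCoincide` ([EtTh] Lemma 5.9 (v) as typed) is
FALSE** (R5: the row is an assumption about NAMED §5/§2 data, never a theorem of the interface; instance forms of
record: `cycRigidityCoincide_of`, `cycRigidityCoincide_of_biTheta`).
[cite: MochizukiEtTh2009, Lem 5.9 (v) p.332 (PDF p.106)] -/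
theorem not_forall_cycRigidityCoincide :
    ¬ ∀ (C : Type) [Category.{0} C] (D : Type) [Category.{0} D] (𝔉 : ThetaFrobenioid.{0} C D)
        (ρ219 : 𝔉.lDeltaModN 𝔉.BN ≃* 𝔉.muTorsion 𝔉.BN 𝔉.N)
        (ρ : FrobenioidCyclotomicRigidity.RigidityFamily 𝔉) (hB : 𝔉.IsThetaSaturated 𝔉.BN),
        𝔉.CycRigidityCoincide ρ219 ρ hB :=
  fun h => not_cycRigidityCoincide_toy (h TC3 TD toyTheta₃ ρ219' ρfam isThetaSaturated_toy)

end Lem59vToy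

end ThetaFrobenioid

end Literature.AnabelianGeometry.EtaleTheta
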